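import Summits.BirchSwinnertonDyer.BirchSwinnertonDyer.Theorems.KatoDescentPotSupersingularWildUpperUnitTwistRecordsFlat54
import Summits.BirchSwinnertonDyer.BirchSwinnertonDyer.Theorems.KatoDescentPotSupersingularWildLowerDesc3RecordsX4ns01
import HarnessLib

/-!
# Route `KatoDescentPotSupersingular` (rung K9, sub-rung B5 = O6 wild `p = 3`, cell `bsd-potss`): `BSD(E,3)` OF THE PAIR for a FIFTH
# U₀-ns ♭ unit-twist row with `#Ш(E)_an = 9` (382347dr1, certified by this seat's deep-search kit j298525; sequel of `…BsdpSha9`) — BOTH halves per row from landed records: the UPPER half (this seat's unit-twist record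
# `missingUpperBoundAt_g<label>_3`, ♭ road p598429 over kmc F15) and the LOWER half (k9-desc3's `3`-descent record
# `K9Desc3.lower3_sel_<label>`, `…WildLowerDesc3RecordsX4ns01`): row 382347dr1 @ 3
# (seat `bsd-potss-k9-c4` g16; `--supports stmt-BirchSwinnertonDyer-19197 --as helper`)

HONEST FRAMING. THEOREMS ONLY; PER PAIR; nothing booked here; items 19189 / 19197 / 19663 stay OPEN class-wide; BSD is not proved
for any class.  On this INTRINSIC wild class (as on the four of `…BsdpSha9`) (X4, mod-3 image 3Nn/3Ns, `r_an = 0`, Cremona `#Ш_an = 9`, `∏c_ℓ` prime to 3,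
single-member isogeny classes) the two landed per-row records meet: `ord₃ #Ш(E) ≥ 2` (Cassels–Tate + `Sel^(3)(E/ℚ) ≠ ⊥` certificate,
k9-desc3 / k9-c2 kit j250472) and `ord₃ #Ш(E) ≤ ord₃ #Ш(E)_an = 2` (Matar–Nekovář 0.3 at a unit rank-one Heegner twist, this seat's
kit j298525, d = −467), so `ord₃ #Ш(E) = ord₃ #Ш(E)_an` and Miller's `BSD(E,3)` follows by `Typed.missingPPartAt_of_lower_of_upper` +
`Typed.bsdp_of_missingPPartAt` — CONDITIONAL on the displayed named facts {Cassels–Tate pairing, GZK, Gross–Zagier, Kolyvagin,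
Matar–Nekovář 2019 Thm 0.3, modularity} and the displayed data of both records (`r_an(E) = 0`, `#Ш_an(E) = 9`, the `3`-descent line
`hSel`, Cremona's `N`, `3 ∤ ∏c_ℓ`, a datum `D` with `3 ∤ c(D)`, the twist's `r_an = 1` and unit `#Ш_an`).  Fifth such K9 U₀-ns pair with NON-trivial `Ш[3]` on the reading-free unit-twist road.

References: [MatarNekovar2019] Thm. 0.3; [GrossZagier1986] I.6.3; [KolyvaginEulerSystems1990] Thm. A; [MilneADT2006] Thm. I.7.3
(Cassels–Tate); [SchaeferStoll2004]; [Miller2011LMS] §1, Def. 1.1; [Darmon2004] Thm. 3.22; [Cremona2006] Tables 1, 4.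
-/

set_option autoImplicit false
set_option linter.dupNamespace false
noncomputable section
open scoped Classical NumberField
open WeierstrassCurve NumberField Field
  Literature.NumberTheory.EllipticCurves
  Literature.NumberTheory.EllipticCurves.ModularForms Literature.NumberTheory.EllipticCurves.Rank1Residual
  Literature.NumberTheory.EllipticCurves.Rank1Residual.Typed Literature.NumberTheory.Automorphic
  Summit.BirchSwinnertonDyer.Rank1Residual Summit.BirchSwinnertonDyer.Rank1Residual.Additive
  Summit.BirchSwinnertonDyer.BirchSwinnertonDyer.Theorems

namespace Summit.BirchSwinnertonDyer.BirchSwinnertonDyer.Theorems.WildUpperUnitTwistRecords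

/-- **`BSD(E,3)` (Miller) for the PAIR `E = 382347dr1`, `p = 3`, with `#Ш(E)_an = 9`** — O6 wild `3` (`N = 382347`), U₀-ns ♭ row (mod-3
image Nn), `r_an = 0`, `∏c_ℓ = 2`: LOWER half = `K9Desc3.lower3_sel_382347dr1` (Cassels–Tate `hCT` + GZK + the displayed
`3`-descent line `hSel : Sel^(3)(E/ℚ) ≠ ⊥`, kit j250472), UPPER half = `missingUpperBoundAt_g382347dr1_3` (MN19 0.3 + GZ + Kolyvagin + GZK +
modularity + the unit rank-one twist `d_K = -467`, kit j298525); together `ord₃ #Ш(E) = ord₃ #Ш(E)_an (= 2)` and GZK closes `BSD(E,3)`.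
CONDITIONAL on the displayed hypotheses; per pair; books nothing by itself. [cite: Miller2011LMS, §1 and Def. 1.1]
[cite: MatarNekovar2019, Thm. 0.3 (p. 456)] [cite: MilneADT2006, Thm. I.7.3] [cite: Cremona2006, Table 4 (Cremona label 382347dr1)] -/
theorem bsdp_g382347dr1_3_of_sel3
    (hCT : exists_casselsTate_pairing (K := ℚ))
    (hGZ : ∀ (N : ℕ) [NeZero N] (W : WeierstrassCurve ℚ) (K : Type) [Field K] [NumberField K],
      gross_zagier N W K)
    (hKo : ∀ (N : ℕ) [NeZero N] (W : WeierstrassCurve ℚ) (K : Type) [Field K] [NumberField K],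
      kolyvagin N W K)
    (hMN : ∀ (N : ℕ) [NeZero N] (W : WeierstrassCurve ℚ) (K : Type) [Field K] [NumberField K],
      MatarNekovar2019.thm03_padicValNat_card_sha_le_of_irreducible N W K)
    (hGZK : rank_eq_analyticRank_of_analyticRank_le_one) (hmod : hasEntireLFunction_rat)
    {W : WeierstrassCurve ℚ} [W.IsElliptic] [W.IsGloballyMinimal] (hWeq : W = (⟨0, 0, 1, (-297381), 61929593⟩ : WeierstrassCurve ℚ))
    (hN : W.conductorNorm ℤ = 382347) (hr : W.analyticRank = 0) (htam : ¬ 3 ∣ W.tamagawaProduct)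
    (D : ModularParametrizationData W 382347) (hc : ¬ (3 : ℤ) ∣ D.c)
    (K : Type) [Field K] [NumberField K] (hK : IsImaginaryQuadratic K) (hdK : NumberField.discr K = -467)
    {Wd : WeierstrassCurve ℚ} [Wd.IsElliptic] [Wd.IsGloballyMinimal] (hWdeq : Wd = (⟨0, 0, 1, (-64855524909), (-6307378150093750)⟩ : WeierstrassCurve ℚ))
    (hrd : Wd.analyticRank = 1) {qd : ℚ} (hqd : shaAn Wd = (qd : ℂ)) (hvd : padicValRat 3 qd ≤ 0)
    {s : ℚ} (hs : shaAn W = (s : ℂ)) (hv : padicValRat 3 s ≤ 2) (hSel : W.selmerGroup (3 : ℤ) ≠ ⊥) :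
    BSDp W 3 :=
  bsdp_of_missingPPartAt W 3 hGZK (by rw [hr]; exact zero_le_one)
    (missingPPartAt_of_lower_of_upper W 3 (K9Desc3.lower3_sel_382347dr1 hCT hGZK W hWeq hr hs hv hSel)
      (missingUpperBoundAt_g382347dr1_3 hGZ hKo hMN hGZK hmod hWeq hN hr htam D hc K hK hdK hWdeq hrd hqd hvd))

end Summit.BirchSwinnertonDyer.BirchSwinnertonDyer.Theorems.WildUpperUnitTwistRecords

end
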